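import Literature.AlgebraicGeometry.Resolution.WeightedBlowupShade
import Mathlib.RingTheory.MvPowerSeries.Order
import Mathlib.RingTheory.MvPowerSeries.NoZeroDivisors
import Mathlib.RingTheory.Valuation.Basic
import Mathlib.Algebra.MvPolynomial.PDeriv
import Mathlib.RingTheory.Polynomial.Basic
import HarnessLib

/-!
# The monomial valuation of a weighted centre: admissibility as a valuative inequality, and when two
# presentations define the same valuation

Topic: `Literature/AlgebraicGeometry/Resolution`.  A companion of `WeightedBlowupShade`
(`WeightedBlowup.monomialValuation γ d = Σ dᵢ γᵢ`, `WeightedBlowup.IsAdmissibleFor γ F`), proving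
the elementary statements about the monomial valuation `v_J` of a centre `J = (x₁^{a₁}, …,
x_k^{a_k})` that Abramovich–Temkin–Włodarczyk and Abramovich–Quek–Schober state and use:

* [AbramovichTemkinWlodarczyk2024] D. Abramovich, M. Temkin, J. Włodarczyk, *Functorial embedded
  resolution via weighted blowings up*, Algebra & Number Theory 18:8 (2024) 1557–1587:
  Def. 2.4.1 (p. 1568) "(2) A center `J` is admissible for a valuative `ℚ`-ideal `β` if `J_v ≤ β_v`
  for all `v`. A center is admissible for an ideal `I` if it is admissible for … `v(I)`";
  "(3) The center `J` is reduced if `wᵢ = 1/aᵢ` are positive integers with `gcd(w₁, …, w_k) = 1`.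
  For any center `J` we write `J̄ = (x₁^{1/w₁}, …, x_k^{1/w_k})` for the unique reduced center such
  that `J̄^ℓ = J` for some `ℓ ∈ ℚ_{>0}`";  Rem. 2.4.2 (p. 1568) "the center `J` corresponds to a
  unique monomial valuation associated to the cocharacter `(a₁⁻¹, …, a_k⁻¹, 0, …, 0)`, where
  `v(∏ xᵢ^{cᵢ}) = Σ cᵢ/aᵢ`";  Rem. 5.2.3 (p. 1576) "In terms of its monomial valuation, `J` is
  admissible for `I` if and only if `v_J(f) ≥ 1` for all `f ∈ I`. This means that if
  `f = Σ c_α x^α` then `Σ αᵢ/aᵢ ≥ 1` whenever `c_α ≠ 0`. This is convenient for testing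
  admissibility, as long as one remembers that `v_{J^m} = v_J/m`";  Lemma 5.2.6 (p. 1577) "If `J` is
  both `I₁`-admissible and `I₂`-admissible then `J` is `I₁ + I₂`-admissible. … Indeed if `v_J(f) ≥
  1` and `v_J(g) ≥ 1` then `v_J(f + g) ≥ 1` and `v_J(f^{c₁}·g^{c₂}) ≥ c₁ + c₂`";  Lemma 5.2.7 (p.
  1577) "If `J` is `I`-admissible then `J' = J^{(a₁−1)/a₁}` is `D(I)`-admissible", proof: "if `Σ
  αᵢ/aᵢ ≥ 1` and `α_j ≥ 1` then `v_J(∂(x^α)/∂x_j) = Σ αᵢ/aᵢ − 1/a_j ≥ 1 − 1/a₁`";  Def. 2.2.1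
  (p. 1567) "Every valuative ideal `γ` defines an ideal sheaf `I_γ` … by taking `I_γ := {f ∈ 𝒪 |
  v(f) ≥ γ_v ∀v}`, which is automatically integrally closed";  Lemma 5.2.10 (p. 1577) "Assume
  `(x₁, x₂, …, x_n)` and `(x₁', x₂, …, x_n)` are both regular sequences of parameters, and suppose
  `(x₁^{a₁}, x₂^{a₂}, …, x_k^{a_k}) ≤ v(x₁'^{a₁})`. Then `(x₁^{a₁}, x₂^{a₂}, …, x_k^{a_k}) =
  (x₁'^{a₁}, x₂^{a₂}, …, x_k^{a_k})` as centers", proof: "`x₁'^{a₁}` lies in the integral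
  closure `(x₁^{a₁}, x₂^{a₂}, …, x_k^{a_k})^{int}`, hence `(x₁'^{a₁}, x₂^{a₂}, …)^{int} ⊂
  (x₁^{a₁}, x₂^{a₂}, …)^{int}`. Since these two ideals have the same Hilbert–Samuel functions
  they coincide";  Thm. 5.3.1 (3) (p. 1578) "Locally at `p`, `J` is the unique admissible center
  with invariant `inv_I(p)`. In particular, it is in fact independent of the maximal contact
  sequence `(x₁, …, x_k)`".
* [AbramovichQuekSchober2024] D. Abramovich, M. H. Quek, B. Schober, *Resolving plane curves using
  stack-theoretic blow-ups*, arXiv:2412.16426, §4: "`J = (x₁^{a₁}, x₂^{a₂})` … the monomial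
  valuation `v_J : 𝒪 ∖ {0} → ℚ` uniquely determined by `v_J(x₁) = 1/a₁, v_J(x₂) = 1/a₂`. Explicitly
  … `v_J(g) = min { i₁/a₁ + i₂/a₂ | d_{i₁,i₂} ≠ 0 }`";  "the data of `(x₁, x₂)` and `(a₁, a₂)`
  determines the valuation but is not uniquely determined by it";  Rem. 4.1 "In [ATW], a more
  global notion of valuative `ℚ`-ideals is used to describe centers. Since we work locally,
  valuations suffice";  "we say that a center `J` is admissible for `f` if `v_J(f) ≥ 1`".

## What is proved (affine/polynomial model `K[x_σ]`; everything elementary, no fact asserted)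

§1 INTEGER NORMAL FORM.  Clearing denominators as in Def. 2.4.1 (3) (`wᵢ = N·γᵢ ∈ ℕ`, `γᵢ = 1/aᵢ`
   the cocharacter of `WeightedBlowupShade`, `N > 0`), `v_J = (1/N)·ν_w` where
   `WeightedBlowup.monomialOrd w F ∈ ℕ∞` is the `w`-weighted order of `F` (Mathlib's
   `MvPowerSeries.weightedOrder` of the polynomial): `isAdmissibleFor_iff_le_monomialOrd` —
   **`J` admissible for `F` ⟺ `N ≤ ν_w(F)`** (Rem. 5.2.3), with `le_monomialOrd_iff` (`n ≤ ν_w(F)`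
   iff every monomial of `F` has weight `≥ n`), `monomialOrd_mul` (a valuation: `ν_w(FG) = ν_w F +
   ν_w G` over a domain), `min_monomialOrd_le_add`, `add_monomialOrd_le_mul`,
   `nsmul_monomialOrd_le_pow`.
§2 THE TEST.  `WeightedBlowup.residualBelow γ F` = the part of `F` on the monomials with `v_J < 1`
   (below the weighted simplex); `residualBelow_eq_zero_iff` — **admissible ⟺ the residual is `0`**
   (the reading of Rem. 5.2.3 "convenient for testing admissibility").
§3 LEMMA 5.2.6.  `IsAdmissibleFor.add`; `le_monomialValuation_of_mem_support_mul`
   (`v_J ≥ c₁` on `F` and `≥ c₂` on `G` ⟹ `v_J ≥ c₁ + c₂` on `FG`); `IsAdmissibleFor.mul_left`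
   (admissibility passes to the ideal generated, Def. 2.4.1 (2) "admissible for an ideal").
§4 LEMMA 5.2.7 (derivatives).  `monomialOrd_le_add_weight_of_support` (an operator shifting supports
   by `−e` lowers `ν_w` by at most `weight e`) and `monomialOrd_le_pderiv_add` —
   **`ν_w(F) ≤ ν_w(∂F/∂x_j) + w_j`**, i.e. `v_J(∂_j F) ≥ v_J(F) − 1/a_j`; the same shift lemma
   covers Hasse–Schmidt derivatives `D_j^{(m)}` (shift `m·e_j`), which is what one uses in
   characteristic `p`.
§5 DEF. 2.4.1 (2) ⟺ REM. 5.2.3 (valuations).  For every additive valuation `v` of `K[x]` centred on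
   the affine space (`v ≥ 0` on `K` and on the `xᵢ`), with values in ANY linearly ordered monoid:
   `centre_le_addValuation_of_le_monomialOrd` — **`v_J(F) ≥ 1 ⟹ J_v ≤ v(F)`**, where
   `J_v = min_{i : wᵢ ≠ 0} aᵢ·v(xᵢ)` is compared through `γ ≤ J_v ⟺ ∀ i, wᵢ•γ ≤ N•v(xᵢ)` (no
   division in the value monoid); the engine is `nsmul_le_addValuation_of_le_monomialOrd` /
   `monomialOrd_le_addValuation` — **every valuation with `v(xᵢ) ≥ wᵢ` dominates `ν_w`**.
   Conversely `ν_w` is itself such a valuation (`WeightedBlowup.monomialAddVal w : AddValuation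
   (K[x]) ℕ∞`, `monomialAddVal_X`), so `le_monomialOrd_iff_forall_addValuation` and
   `monomialOrd_eq_iInf`: **`ν_w` is the minimum of all valuations `v` of `K[x]` with `v(xᵢ) ≥
   wᵢ`** — the monomial valuation "uniquely determined by `v_J(xᵢ) = 1/aᵢ`" (AQS §4) is the least
   one with these values.
§6 TWO PRESENTATIONS (AQS §4: "the data … determines the valuation but is not uniquely determined by
   it").  A second coordinate system is a `K`-algebra automorphism `Ψ` of `K[x]` (new coordinates
   `Xⱼ := Ψ(xⱼ)`, a polynomial `g` "written in the `X`" is `Ψ⁻¹ g`), and the monomial valuation with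
   weights `w'` on the `X` is `μ = ν_{w'} ∘ Ψ⁻¹` (`AddValuation.comap`).
   `comap_monomialAddVal_eq_iff` — **`μ = ν_w ⟺ (∀ j, wⱼ ≤ μ(xⱼ)) ∧ (∀ j, w'ⱼ ≤ ν_w(Xⱼ))`**: two
   weighted coordinate systems define the same monomial valuation iff each dominates the other's
   weights on the other's coordinates (both directions are §5).  This is the exact test by which a
   computation decides that a re-run of a centre-choosing recipe in coordinates adapted to its
   previous output returned THE SAME centre (as a valuation / valuative `ℚ`-ideal) although the
   coordinates moved.

§7 READ OFF THE MINIMUM FORMULA.  `monomialOrd_mul_of_constantCoeff_ne_zero` —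
   **`ν_w(u·G) = ν_w(G)` for `u(0) ≠ 0`** (units do not change `v_J`);
   `le_mul_degree_of_le_monomialOrd` / `le_degree_of_isAdmissibleFor` — **the first-entry bound
   `a₁ ≤ ord F`**: an admissible centre's smallest exponent is at most the degree of every monomial
   of `F` (AQS, proof of Thm. 4.2, "Uniqueness of `a₁`": "since `(y₁^{b₁}, y₂^{b₂})` is admissible
   and `b₁ ≤ b₂`, we have `b₁ ≤ ν`").
§8 RIGIDITY (Lemma 5.2.10 with all parameters moving at once; Thm. 5.3.1 (3) "independent of the
   maximal contact sequence").  `monomialOrd_le_monomialOrd_map` — a ring endomorphism `φ` of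
   `K[x]` with `ν_w(φ xᵢ) ≥ wᵢ` satisfies **`ν_w ∘ φ ≥ ν_w`** (so `φ` maps every valuation ideal
   `F_c = {G : c ≤ ν_w G}` — the `I_γ` of Def. 2.2.1, ideals for every weight vector, weights `0`
   included — into itself); and for an AUTOMORPHISM `Ψ` of `K[x]` (`σ` finite, `K` a Noetherian
   domain) with `ν_w(Ψ xᵢ) ≥ wᵢ`: `monomialOrd_ringEquiv_eq` — **`ν_w(Ψ G) = ν_w(G)` for all `G`**
   (`Ψ⁻¹(F_c) = F_c`: the chain `F_c ≤ Ψ⁻¹F_c ≤ Ψ⁻²F_c ≤ ⋯` is stationary and `Ψ⁻¹` is injective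
   on ideals — the ascending chain condition replaces the Hilbert–Samuel functions of the
   published proof), `monomialOrd_ringEquiv_X` / `monomialOrd_ringEquiv_symm_X`
   — **`ν_w(Ψ xᵢ) = wᵢ = ν_w(Ψ⁻¹ xᵢ)`** (the ONE-SIDED hypothesis already gives both conditions of
   §6), and `comap_monomialAddVal_symm_eq_of_le` — **`ν_w ∘ Ψ⁻¹ = ν_w`**: parameters `Xᵢ = Ψ(xᵢ)`
   with `ν_w(Xᵢ) ≥ wᵢ` present THE SAME centre `(Xᵢ^{N/wᵢ}) = (xᵢ^{N/wᵢ})` (same monomial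
   valuation, same valuative `ℚ`-ideal, same admissibility: `le_monomialOrd_symm_iff`).  The
   published Lemma 5.2.10 is the case where `Ψ` moves one parameter.

Conventions.  `σ` any index type (no finiteness needed except where Mathlib's `pderiv` is used and in
the rigidity statements of §8, which need `K[x]` Noetherian: `σ` finite, `K` Noetherian);
`K` a commutative ring (§1–§4, §5 domination), a domain where `ν_w` is packaged as a valuation
(§5–§6, §8). Weights `w : σ → ℕ` with `wᵢ = 0` allowed (variables outside the centre).  Nothing here
concerns the CHOICE of the centre (the invariant), blow-ups, or transforms.
-/

namespace Literature.AlgebraicGeometry.Resolution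

namespace WeightedBlowup

open MvPolynomial

noncomputable section

variable {σ : Type*} {K : Type*} [CommRing K]

/-! ## §1 The integer normal form `ν_w` of the monomial valuation -/

/-- **The `w`-weighted order `ν_w(F) = min { Σ wᵢ dᵢ : coeff_d F ≠ 0 } ∈ ℕ∞`** of a polynomial
(`⊤` for `F = 0`): the monomial valuation of the centre in integer normal form, `v_J = ν_w / N` when
`wᵢ = N/aᵢ` (Mathlib's `MvPowerSeries.weightedOrder` of `F` viewed as a power series).
[cite: AbramovichTemkinWlodarczyk2024, Rem. 2.4.2 and Def. 2.4.1 (3) (monomial valuation of a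
center; reduced center with integer weights)] -/
def monomialOrd (w : σ → ℕ) (F : MvPolynomial σ K) : ℕ∞ :=
  (F : MvPowerSeries σ K).weightedOrder w

/-- `ν_w(0) = ⊤`. [cite: AbramovichTemkinWlodarczyk2024, Rem. 2.4.2] -/
theorem monomialOrd_zero (w : σ → ℕ) : monomialOrd w (0 : MvPolynomial σ K) = ⊤ := by
  simp [monomialOrd, MvPolynomial.coe_zero]

/-- `ν_w(F) = ⊤ ⟺ F = 0`. [cite: AbramovichTemkinWlodarczyk2024, Rem. 2.4.2] -/
theorem monomialOrd_eq_top_iff (w : σ → ℕ) (F : MvPolynomial σ K) :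
    monomialOrd w F = ⊤ ↔ F = 0 := by
  rw [monomialOrd, MvPowerSeries.weightedOrder_eq_top_iff, MvPolynomial.coe_eq_zero_iff]

/-- `ν_w(F) ≤ weight(d)` for every monomial `d` of `F`.
[cite: AbramovichQuekSchober2024, §4 (v_J(g) = min over the monomials of g)] -/
theorem monomialOrd_le_weight (w : σ → ℕ) {F : MvPolynomial σ K} {d : σ →₀ ℕ}
    (hd : d ∈ F.support) : monomialOrd w F ≤ Finsupp.weight w d := by
  apply MvPowerSeries.weightedOrder_le
  rw [MvPolynomial.coeff_coe]
  exact mem_support_iff.mp hd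

/-- **`n ≤ ν_w(F)` iff every monomial of `F` has `w`-weight `≥ n`** ("`Σ αᵢ/aᵢ ≥ 1` whenever
`c_α ≠ 0`"). [cite: AbramovichTemkinWlodarczyk2024, Rem. 5.2.3] -/
theorem le_monomialOrd_iff (w : σ → ℕ) (F : MvPolynomial σ K) (n : ℕ) :
    (n : ℕ∞) ≤ monomialOrd w F ↔ ∀ d ∈ F.support, n ≤ Finsupp.weight w d := by
  constructor
  · intro h d hd
    exact_mod_cast h.trans (monomialOrd_le_weight w hd)
  · intro h
    apply MvPowerSeries.nat_le_weightedOrder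
    intro d hd
    rw [MvPolynomial.coeff_coe]
    by_contra hne
    exact (not_lt.mpr (h d (mem_support_iff.mpr hne))) hd

/-- The minimum is attained: some monomial of `F ≠ 0` has weight `ν_w(F)`.
[cite: AbramovichQuekSchober2024, §4 (v_J(g) = min over the monomials of g)] -/
theorem exists_weight_eq_monomialOrd (w : σ → ℕ) {F : MvPolynomial σ K} (hF : F ≠ 0) :
    ∃ d ∈ F.support, (Finsupp.weight w d : ℕ∞) = monomialOrd w F := by
  have h : ((monomialOrd w F).toNat : ℕ∞) = monomialOrd w F :=
    ENat.coe_toNat (by rw [ne_eq, monomialOrd_eq_top_iff]; exact hF)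
  obtain ⟨d, hd, hdw⟩ := MvPowerSeries.exists_coeff_ne_zero_and_weightedOrder w h
  refine ⟨d, ?_, hdw⟩
  rw [MvPolynomial.coeff_coe] at hd
  exact mem_support_iff.mpr hd

/-- **Admissibility in integer normal form: `J` is admissible for `F` ⟺ `N ≤ ν_w(F)`**, for the
cocharacter `γ` (`γᵢ = 1/aᵢ` on the centre variables, `0` elsewhere) and integer weights
`wᵢ = N·γᵢ` (`N > 0`; e.g. `N = ℓ` and `w` the reduced weights of Def. 2.4.1 (3)).
[cite: AbramovichTemkinWlodarczyk2024, Rem. 5.2.3 (J admissible ⟺ v_J(f) ≥ 1 ⟺ Σ αᵢ/aᵢ ≥ 1 on the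
monomials) and Def. 2.4.1 (3)] -/
theorem isAdmissibleFor_iff_le_monomialOrd (γ : σ → ℚ) (w : σ → ℕ) {N : ℕ} (hN : 0 < N)
    (hw : ∀ i, (w i : ℚ) = N * γ i) (F : MvPolynomial σ K) :
    IsAdmissibleFor γ F ↔ (N : ℕ∞) ≤ monomialOrd w F := by
  rw [le_monomialOrd_iff]
  have hNq : (0 : ℚ) < N := by exact_mod_cast hN
  have key : ∀ d : σ →₀ ℕ, (N : ℚ) * monomialValuation γ d = (Finsupp.weight w d : ℚ) := by
    intro d
    rw [monomialValuation, Finsupp.sum, Finset.mul_sum, Finsupp.weight_apply, Finsupp.sum,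
      Nat.cast_sum]
    refine Finset.sum_congr rfl fun i _ => ?_
    rw [smul_eq_mul, Nat.cast_mul, hw i]
    ring
  refine forall₂_congr fun d _ => ?_
  rw [← mul_le_mul_iff_of_pos_left hNq, mul_one, key, Nat.cast_le]

/-- `min (ν_w F) (ν_w G) ≤ ν_w(F + G)`. [cite: AbramovichTemkinWlodarczyk2024, Lemma 5.2.6
(v_J(f) ≥ 1, v_J(g) ≥ 1 ⟹ v_J(f+g) ≥ 1)] -/
theorem min_monomialOrd_le_add (w : σ → ℕ) (F G : MvPolynomial σ K) :
    min (monomialOrd w F) (monomialOrd w G) ≤ monomialOrd w (F + G) := by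
  simp only [monomialOrd, MvPolynomial.coe_add]
  exact MvPowerSeries.min_weightedOrder_le_add w

/-- `ν_w F + ν_w G ≤ ν_w(FG)` (any coefficient ring). [cite: AbramovichTemkinWlodarczyk2024,
Lemma 5.2.6 (v_J(f^{c₁} g^{c₂}) ≥ c₁ + c₂)] -/
theorem add_monomialOrd_le_mul (w : σ → ℕ) (F G : MvPolynomial σ K) :
    monomialOrd w F + monomialOrd w G ≤ monomialOrd w (F * G) := by
  simp only [monomialOrd, MvPolynomial.coe_mul]
  exact MvPowerSeries.le_weightedOrder_mul w

/-- `k • ν_w F ≤ ν_w(F^k)` ("if `J` is `I`-admissible then `J^k` is `I^k`-admissible").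
[cite: AbramovichTemkinWlodarczyk2024, Lemma 5.2.6] -/
theorem nsmul_monomialOrd_le_pow (w : σ → ℕ) (F : MvPolynomial σ K) (k : ℕ) :
    k • monomialOrd w F ≤ monomialOrd w (F ^ k) := by
  simp only [monomialOrd, MvPolynomial.coe_pow]
  exact MvPowerSeries.le_weightedOrder_pow w k

/-- **`ν_w` is a valuation over a domain: `ν_w(FG) = ν_w F + ν_w G`.**
[cite: AbramovichQuekSchober2024, §4 (the monomial valuation v_J)] -/
theorem monomialOrd_mul [NoZeroDivisors K] (w : σ → ℕ) (F G : MvPolynomial σ K) :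
    monomialOrd w (F * G) = monomialOrd w F + monomialOrd w G := by
  simp only [monomialOrd, MvPolynomial.coe_mul]
  exact MvPowerSeries.weightedOrder_mul w _ _

/-- `ν_w(c·x^d) = weight(d)` for `c ≠ 0`. [cite: AbramovichTemkinWlodarczyk2024, Rem. 2.4.2
(v(∏ xᵢ^{cᵢ}) = Σ cᵢ/aᵢ)] -/
theorem monomialOrd_monomial (w : σ → ℕ) (d : σ →₀ ℕ) {c : K} (hc : c ≠ 0) :
    monomialOrd w (monomial d c) = Finsupp.weight w d := by
  simp only [monomialOrd, MvPolynomial.coe_monomial]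
  exact MvPowerSeries.weightedOrder_monomial_of_ne_zero w hc

/-- `ν_w(xᵢ) = wᵢ`. [cite: AbramovichQuekSchober2024, §4 (v_J(xᵢ) = 1/aᵢ)] -/
theorem monomialOrd_X [Nontrivial K] (w : σ → ℕ) (i : σ) :
    monomialOrd w (X i : MvPolynomial σ K) = w i := by
  rw [X, monomialOrd_monomial w _ one_ne_zero, Finsupp.weight_single, one_smul]

/-- `ν_w(c) = 0` for a non-zero constant. [cite: AbramovichTemkinWlodarczyk2024, Rem. 2.4.2] -/
theorem monomialOrd_C [Nontrivial K] (w : σ → ℕ) {c : K} (hc : c ≠ 0) :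
    monomialOrd w (C c : MvPolynomial σ K) = 0 := by
  rw [C_apply, monomialOrd_monomial w _ hc, map_zero, Nat.cast_zero]

/-! ## §2 The admissibility test: the residual below the weighted simplex -/

/-- **The residual of `F` below the weighted simplex**: the sum of the monomials `c_d x^d` of `F`
with `v_J(x^d) = Σ dᵢ γᵢ < 1` — the object one computes to test admissibility.
[cite: AbramovichTemkinWlodarczyk2024, Rem. 5.2.3 ("Σ αᵢ/aᵢ ≥ 1 whenever c_α ≠ 0. This is convenient
for testing admissibility")] -/
def residualBelow (γ : σ → ℚ) (F : MvPolynomial σ K) : MvPolynomial σ K :=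
  ∑ d ∈ F.support with monomialValuation γ d < 1, monomial d (coeff d F)

/-- Coefficients of the residual. [cite: AbramovichTemkinWlodarczyk2024, Rem. 5.2.3] -/
theorem coeff_residualBelow (γ : σ → ℚ) (F : MvPolynomial σ K) (d : σ →₀ ℕ) :
    coeff d (residualBelow γ F) = if monomialValuation γ d < 1 then coeff d F else 0 := by
  classical
  simp only [residualBelow, coeff_sum, coeff_monomial, Finset.sum_ite_eq', Finset.mem_filter,
    mem_support_iff]
  by_cases h1 : monomialValuation γ d < 1
  · by_cases h2 : coeff d F = 0
    · simp [h1, h2]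
    · simp [h1, h2]
  · simp [h1]

/-- **`J` is admissible for `F` ⟺ the residual of `F` below the weighted simplex vanishes.**
[cite: AbramovichTemkinWlodarczyk2024, Rem. 5.2.3 (admissible ⟺ Σ αᵢ/aᵢ ≥ 1 whenever c_α ≠ 0)];
[cite: AbramovichQuekSchober2024, §4 ("a center J is admissible for f if v_J(f) ≥ 1")] -/
theorem residualBelow_eq_zero_iff (γ : σ → ℚ) (F : MvPolynomial σ K) :
    residualBelow γ F = 0 ↔ IsAdmissibleFor γ F := by
  classical
  constructor
  · intro h d hd
    by_contra hlt
    have hc := congrArg (coeff d) h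
    rw [coeff_residualBelow, if_pos (not_le.mp hlt), coeff_zero] at hc
    exact (mem_support_iff.mp hd) hc
  · intro h
    ext d
    rw [coeff_residualBelow, coeff_zero]
    split_ifs with hlt
    · by_contra hne
      exact (not_le.mpr hlt) (h d (mem_support_iff.mpr hne))
    · rfl

/-! ## §3 Lemma 5.2.6: sums, products, the ideal generated -/

omit [CommRing K] in
/-- `v_J` is additive on exponents. [folklore] -/
private theorem monomialValuation_add_aux (γ : σ → ℚ) (d₁ d₂ : σ →₀ ℕ) :
    monomialValuation γ (d₁ + d₂) = monomialValuation γ d₁ + monomialValuation γ d₂ := by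
  simp only [monomialValuation]
  rw [Finsupp.sum_add_index']
  · intro i; simp
  · intro i a b; push_cast; ring

omit [CommRing K] in
/-- `v_J ≥ 0` on monomials for a non-negative cocharacter. [folklore] -/
private theorem monomialValuation_nonneg_aux {γ : σ → ℚ} (hγ : ∀ i, 0 ≤ γ i) (d : σ →₀ ℕ) :
    0 ≤ monomialValuation γ d := by
  simp only [monomialValuation, Finsupp.sum]
  exact Finset.sum_nonneg fun i _ => mul_nonneg (Nat.cast_nonneg _) (hγ i)

/-- **Lemma 5.2.6 (sums): `J` admissible for `F` and for `G` ⟹ admissible for `F + G`.**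
[cite: AbramovichTemkinWlodarczyk2024, Lemma 5.2.6 (I₁- and I₂-admissible ⟹ (I₁+I₂)-admissible)] -/
theorem IsAdmissibleFor.add {γ : σ → ℚ} {F G : MvPolynomial σ K} (hF : IsAdmissibleFor γ F)
    (hG : IsAdmissibleFor γ G) : IsAdmissibleFor γ (F + G) := by
  classical
  intro d hd
  rcases Finset.mem_union.mp (support_add hd) with h | h
  · exact hF d h
  · exact hG d h

/-- **Lemma 5.2.6 (products): if `v_J ≥ c₁` on the monomials of `F` and `v_J ≥ c₂` on those of `G`,
then `v_J ≥ c₁ + c₂` on the monomials of `FG`** ("`v_J(f^{c₁}·g^{c₂}) ≥ c₁ + c₂`"; with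
`v_{J^m} = v_J/m` this is "`J^{c₁+c₂}` is `I₁I₂`-admissible").
[cite: AbramovichTemkinWlodarczyk2024, Lemma 5.2.6 and Rem. 5.2.3 (v_{J^m} = v_J/m)] -/
theorem le_monomialValuation_of_mem_support_mul {γ : σ → ℚ} {F G : MvPolynomial σ K} {c₁ c₂ : ℚ}
    (hF : ∀ d ∈ F.support, c₁ ≤ monomialValuation γ d)
    (hG : ∀ d ∈ G.support, c₂ ≤ monomialValuation γ d) :
    ∀ d ∈ (F * G).support, c₁ + c₂ ≤ monomialValuation γ d := by
  classical
  intro d hd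
  obtain ⟨a, ha, b, hb, rfl⟩ := Finset.mem_add.mp (support_mul F G hd)
  rw [monomialValuation_add_aux]
  exact add_le_add (hF a ha) (hG b hb)

/-- **Admissibility passes to the ideal generated**: for a non-negative cocharacter, `J` admissible
for `G` ⟹ admissible for `F·G` (so "admissible for `I`" only depends on generators of `I`).
[cite: AbramovichTemkinWlodarczyk2024, Def. 2.4.1 (2) and Rem. 5.2.3 (admissible for an ideal I ⟺
v_J(f) ≥ 1 for all f ∈ I)] -/
theorem IsAdmissibleFor.mul_left {γ : σ → ℚ} (hγ : ∀ i, 0 ≤ γ i) (F : MvPolynomial σ K)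
    {G : MvPolynomial σ K} (hG : IsAdmissibleFor γ G) : IsAdmissibleFor γ (F * G) := by
  intro d hd
  have h := le_monomialValuation_of_mem_support_mul (γ := γ) (c₁ := 0) (c₂ := 1)
    (fun a _ => monomialValuation_nonneg_aux hγ a) hG d hd
  rwa [zero_add] at h

/-! ## §4 Lemma 5.2.7: derivatives lower `v_J` by at most `1/a_j` -/

/-- **Support-shift lemma.** If every monomial `d` of `G` comes from the monomial `d + e` of `F`
(as for `G = ∂F/∂x_j`, `e = e_j`, or a Hasse–Schmidt derivative `D_j^{(m)}F`, `e = m·e_j`), then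
`ν_w(F) ≤ ν_w(G) + weight(e)`. [cite: AbramovichTemkinWlodarczyk2024, Lemma 5.2.7 (proof:
v_J(∂x^α/∂x_j) = Σ αᵢ/aᵢ − 1/a_j)] -/
theorem monomialOrd_le_add_weight_of_support (w : σ → ℕ) {F G : MvPolynomial σ K} (e : σ →₀ ℕ)
    (h : ∀ d ∈ G.support, d + e ∈ F.support) :
    monomialOrd w F ≤ monomialOrd w G + Finsupp.weight w e := by
  by_cases hG : G = 0
  · rw [hG, monomialOrd_zero, top_add]; exact le_top
  obtain ⟨d, hd, hdw⟩ := exists_weight_eq_monomialOrd w hG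
  rw [← hdw, ← Nat.cast_add, ← map_add]
  exact monomialOrd_le_weight w (h d hd)

/-- **Lemma 5.2.7: `ν_w(F) ≤ ν_w(∂F/∂x_j) + w_j`**, i.e. `v_J(∂_j F) ≥ v_J(F) − 1/a_j ≥ v_J(F) −
1/a₁` ("if `J` is `I`-admissible then `J^{(a₁−1)/a₁}` is `D(I)`-admissible").
[cite: AbramovichTemkinWlodarczyk2024, Lemma 5.2.7] -/
theorem monomialOrd_le_pderiv_add (w : σ → ℕ) (F : MvPolynomial σ K) (j : σ) :
    monomialOrd w F ≤ monomialOrd w (pderiv j F) + w j := by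
  have h := monomialOrd_le_add_weight_of_support w (F := F) (G := pderiv j F)
    (Finsupp.single j 1) ?_
  · simpa [Finsupp.weight_single] using h
  · intro d hd
    rw [mem_support_iff, coeff_pderiv] at hd
    exact mem_support_iff.mpr (left_ne_zero_of_mul hd)

/-! ## §5 Def. 2.4.1 (2) ⟺ Rem. 5.2.3: admissibility as an inequality of valuative ideals -/

/-- An additive valuation of a commutative ring takes products over a finset to sums. [folklore] -/
private theorem addValuation_map_prod_aux {R : Type*} [CommRing R] {Γ₀ : Type*}
    [LinearOrderedAddCommMonoidWithTop Γ₀] (v : AddValuation R Γ₀) {ι : Type*} (s : Finset ι)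
    (f : ι → R) : v (∏ i ∈ s, f i) = ∑ i ∈ s, v (f i) := by
  classical
  induction s using Finset.induction_on with
  | empty => simp
  | insert a s ha ih => rw [Finset.prod_insert ha, Finset.sum_insert ha, AddValuation.map_mul, ih]

/-- **Domination (any value monoid).** Let `v` be an additive valuation of `K[x]`, non-negative on
the constants, and `γ ≥ 0` a value with `wᵢ•γ ≤ v(xᵢ)` for all `i`.  Then `n ≤ ν_w(F)` implies
`n•γ ≤ v(F)`: a valuation dominating the weights on the coordinates dominates the monomial valuation
(`v(Σ c_α x^α) ≥ min_α (v(c_α) + Σ αᵢ v(xᵢ)) ≥ min_α Σ αᵢwᵢ•γ`).  This is the content of the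
equivalence "admissible for all `v`" (Def. 2.4.1 (2)) ⟺ "`v_J ≥ 1`" (Rem. 5.2.3).
[cite: AbramovichTemkinWlodarczyk2024, Def. 2.4.1 (2) and Rem. 5.2.3];
[cite: AbramovichQuekSchober2024, Rem. 4.1 ("Since we work locally, valuations suffice")] -/
theorem nsmul_le_addValuation_of_le_monomialOrd {Γ₀ : Type*} [LinearOrderedAddCommMonoidWithTop Γ₀]
    (v : AddValuation (MvPolynomial σ K) Γ₀) (hC : ∀ c : K, 0 ≤ v (C c)) (w : σ → ℕ) {γ : Γ₀}
    (hγ : 0 ≤ γ) (hX : ∀ i, w i • γ ≤ v (X i)) (F : MvPolynomial σ K) {n : ℕ}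
    (hn : (n : ℕ∞) ≤ monomialOrd w F) : n • γ ≤ v F := by
  rw [le_monomialOrd_iff] at hn
  conv_rhs => rw [F.as_sum]
  apply AddValuation.map_le_sum
  intro d hd
  rw [monomial_eq, AddValuation.map_mul, Finsupp.prod, addValuation_map_prod_aux]
  simp only [AddValuation.map_pow]
  calc n • γ ≤ (Finsupp.weight w d) • γ := nsmul_le_nsmul_left hγ (hn d hd)
    _ = ∑ i ∈ d.support, d i • (w i • γ) := by
        rw [Finsupp.weight_apply, Finsupp.sum, Finset.sum_smul]
        refine Finset.sum_congr rfl fun i _ => ?_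
        rw [smul_eq_mul, mul_smul]
    _ ≤ ∑ i ∈ d.support, d i • v (X i) :=
        Finset.sum_le_sum fun i _ => nsmul_le_nsmul_right (hX i) _
    _ = 0 + ∑ i ∈ d.support, d i • v (X i) := (zero_add _).symm
    _ ≤ v (C (coeff d F)) + ∑ i ∈ d.support, d i • v (X i) := by
        gcongr
        exact hC _

/-- `N • ⊤ = ⊤` for `N ≠ 0`. [folklore] -/
private theorem nsmul_top_aux {Γ₀ : Type*} [LinearOrderedAddCommMonoidWithTop Γ₀] {N : ℕ}
    (hN : N ≠ 0) : N • (⊤ : Γ₀) = ⊤ := by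
  obtain ⟨k, rfl⟩ := Nat.exists_eq_succ_of_ne_zero hN
  rw [succ_nsmul, add_top]

/-- The multiple `N • v` (`N ≠ 0`) of an additive valuation is an additive valuation. [folklore] -/
private def nsmulAddValAux {R : Type*} [CommRing R] {Γ₀ : Type*}
    [LinearOrderedAddCommMonoidWithTop Γ₀] (v : AddValuation R Γ₀) (N : ℕ) (hN : N ≠ 0) :
    AddValuation R Γ₀ :=
  AddValuation.of (fun f => N • v f)
    (by rw [AddValuation.map_zero]; exact nsmul_top_aux hN)
    (by rw [AddValuation.map_one, nsmul_zero])
    (fun x y => by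
      have hm : Monotone fun g : Γ₀ => N • g := fun a b hab => nsmul_le_nsmul_right hab N
      rw [← hm.map_min]
      exact nsmul_le_nsmul_right (v.map_add x y) N)
    (fun x y => by rw [AddValuation.map_mul, nsmul_add])

/-- **Def. 2.4.1 (2) from Rem. 5.2.3: if `v_J(F) ≥ 1` then `J_v ≤ v(F)` for every valuation `v` of
`K[x]` centred on the affine space** (`v ≥ 0` on constants and coordinates), with values in any
linearly ordered monoid.  Here `J = (xᵢ^{aᵢ})_{wᵢ ≠ 0}`, `aᵢ = N/wᵢ`, `J_v = min_{wᵢ ≠ 0} aᵢ·v(xᵢ)`,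
and "`γ ≤ J_v`" is spelled `∀ i, wᵢ ≠ 0 → wᵢ•γ ≤ N•v(xᵢ)`; the conclusion `N•γ ≤ N•v(F)` is
`γ ≤ v(F)` up to the (injective, for torsion-free values) multiplication by `N`.
[cite: AbramovichTemkinWlodarczyk2024, Def. 2.4.1 (2) (J admissible for β iff J_v ≤ β_v for all v)
and Rem. 5.2.3] -/
theorem centre_le_addValuation_of_le_monomialOrd {Γ₀ : Type*}
    [LinearOrderedAddCommMonoidWithTop Γ₀] (v : AddValuation (MvPolynomial σ K) Γ₀)
    (hC : ∀ c : K, 0 ≤ v (C c)) (hX0 : ∀ i, 0 ≤ v (X i)) (w : σ → ℕ) {N : ℕ} (hN : N ≠ 0)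
    (F : MvPolynomial σ K) (hF : (N : ℕ∞) ≤ monomialOrd w F) {γ : Γ₀} (hγ : 0 ≤ γ)
    (hJ : ∀ i, w i ≠ 0 → w i • γ ≤ N • v (X i)) : N • γ ≤ N • v F := by
  have hJ' : ∀ i, w i • γ ≤ N • v (X i) := fun i => by
    by_cases hw : w i = 0
    · rw [hw, zero_nsmul]; exact nsmul_nonneg (hX0 i) N
    · exact hJ i hw
  exact nsmul_le_addValuation_of_le_monomialOrd (nsmulAddValAux v N hN)
    (fun c => nsmul_nonneg (hC c) N) w hγ hJ' F hF

/-- **Domination, `ℕ∞`-valued form: every additive valuation `v` of `K[x]` with `v(xᵢ) ≥ wᵢ`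
satisfies `v ≥ ν_w`.** [cite: AbramovichTemkinWlodarczyk2024, Def. 2.4.1 (2) and Rem. 5.2.3];
[cite: AbramovichQuekSchober2024, §4 (v_J "uniquely determined by v_J(xᵢ) = 1/aᵢ")] -/
theorem monomialOrd_le_addValuation (v : AddValuation (MvPolynomial σ K) ℕ∞) (w : σ → ℕ)
    (hX : ∀ i, (w i : ℕ∞) ≤ v (X i)) (F : MvPolynomial σ K) : monomialOrd w F ≤ v F := by
  by_cases hF : F = 0
  · rw [hF, AddValuation.map_zero]; exact le_top
  obtain ⟨d, -, hdw⟩ := exists_weight_eq_monomialOrd w hF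
  rw [← hdw]
  have h := nsmul_le_addValuation_of_le_monomialOrd v (fun c => bot_le (a := v (C c))) w
    (γ := (1 : ℕ∞)) zero_le_one (fun i => by rw [nsmul_eq_mul, mul_one]; exact hX i) F
    (n := Finsupp.weight w d) (by rw [hdw])
  rwa [nsmul_eq_mul, mul_one] at h

variable [IsDomain K]

/-- **The monomial valuation `ν_w` as an additive valuation of `K[x]`** (`K` a domain), with values
in `ℕ∞`: `ν_w(FG) = ν_w F + ν_w G`, `ν_w(F + G) ≥ min`, `ν_w 0 = ⊤`, `ν_w 1 = 0`.
[cite: AbramovichQuekSchober2024, §4 (the monomial valuation v_J : 𝒪 ∖ {0} → ℚ)];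
[cite: AbramovichTemkinWlodarczyk2024, Rem. 2.4.2] -/
def monomialAddVal (w : σ → ℕ) : AddValuation (MvPolynomial σ K) ℕ∞ :=
  AddValuation.of (monomialOrd w) (monomialOrd_zero w)
    (by simp [monomialOrd, MvPolynomial.coe_one])
    (min_monomialOrd_le_add w) (monomialOrd_mul w)

/-- `monomialAddVal w F = ν_w(F)`. [cite: AbramovichTemkinWlodarczyk2024, Rem. 2.4.2] -/
@[simp] theorem monomialAddVal_apply (w : σ → ℕ) (F : MvPolynomial σ K) :
    monomialAddVal w F = monomialOrd w F := rfl

/-- `ν_w(xᵢ) = wᵢ`. [cite: AbramovichQuekSchober2024, §4 (v_J(xᵢ) = 1/aᵢ)] -/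
theorem monomialAddVal_X (w : σ → ℕ) (i : σ) :
    monomialAddVal w (X i : MvPolynomial σ K) = w i := by
  rw [monomialAddVal_apply, monomialOrd_X]

/-- **Rem. 5.2.3 ⟺ Def. 2.4.1 (2), `ℕ∞` form: `n ≤ ν_w(F)` iff `n ≤ v(F)` for EVERY additive
valuation `v` of `K[x]` with `v(xᵢ) ≥ wᵢ`** (⟹ domination; ⟸ `v = ν_w`).
[cite: AbramovichTemkinWlodarczyk2024, Def. 2.4.1 (2) and Rem. 5.2.3];
[cite: AbramovichQuekSchober2024, Rem. 4.1] -/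
theorem le_monomialOrd_iff_forall_addValuation (w : σ → ℕ) (F : MvPolynomial σ K) (n : ℕ∞) :
    n ≤ monomialOrd w F ↔ ∀ v : AddValuation (MvPolynomial σ K) ℕ∞,
      (∀ i, (w i : ℕ∞) ≤ v (X i)) → n ≤ v F := by
  constructor
  · intro h v hX
    exact h.trans (monomialOrd_le_addValuation v w hX F)
  · intro h
    exact h (monomialAddVal w) fun i => (monomialAddVal_X w i).ge

/-- **`ν_w` is the least additive valuation of `K[x]` with `v(xᵢ) ≥ wᵢ`** (an infimum, attained):
the monomial valuation "uniquely determined by `v_J(xᵢ) = 1/aᵢ`" is the minimum of all valuations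
with at least these values on the coordinates.
[cite: AbramovichQuekSchober2024, §4]; [cite: AbramovichTemkinWlodarczyk2024, Def. 2.4.1 (2),
Rem. 2.4.2, Rem. 5.2.3] -/
theorem monomialOrd_eq_iInf (w : σ → ℕ) (F : MvPolynomial σ K) :
    monomialOrd w F = ⨅ v : {v : AddValuation (MvPolynomial σ K) ℕ∞ // ∀ i, (w i : ℕ∞) ≤ v (X i)},
      (v : AddValuation (MvPolynomial σ K) ℕ∞) F := by
  apply le_antisymm
  · exact le_iInf fun v => monomialOrd_le_addValuation v.1 w v.2 F
  · exact iInf_le_of_le ⟨monomialAddVal w, fun i => (monomialAddVal_X w i).ge⟩ le_rfl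

/-! ## §6 When two weighted coordinate systems define the same monomial valuation -/

/-- **Same centre in moved coordinates.** Let `Ψ` be a `K`-algebra automorphism of `K[x]` (new
coordinates `Xⱼ = Ψ(xⱼ)`; `Ψ⁻¹ g` is `g` written in the `X`), `w, w'` weights on the `x` resp. the
`X`, and `μ = ν_{w'} ∘ Ψ⁻¹` the monomial valuation of the centre `(Xⱼ^{N/w'ⱼ})`.  Then
**`μ = ν_w ⟺ (∀ j, wⱼ ≤ μ(xⱼ)) ∧ (∀ j, w'ⱼ ≤ ν_w(Xⱼ))`** — the two presentations give the same
valuation (the same valuative `ℚ`-ideal, the same centre) iff each valuation dominates the other's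
weights on the other's coordinates; `⟸` is domination (§5) in both directions.  ("The data of
`(x₁, x₂)` and `(a₁, a₂)` determines the valuation but is not uniquely determined by it.")
[cite: AbramovichQuekSchober2024, §4]; [cite: AbramovichTemkinWlodarczyk2024, Rem. 2.4.2
(a center corresponds to a unique monomial valuation) and Def. 2.4.1 (2)] -/
theorem comap_monomialAddVal_eq_iff (w w' : σ → ℕ)
    (Ψ : MvPolynomial σ K ≃ₐ[K] MvPolynomial σ K) :
    (monomialAddVal w').comap (Ψ.symm : MvPolynomial σ K →+* MvPolynomial σ K) =
        monomialAddVal w ↔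
      (∀ i, (w i : ℕ∞) ≤ monomialOrd w' (Ψ.symm (X i))) ∧
        (∀ i, (w' i : ℕ∞) ≤ monomialOrd w (Ψ (X i))) := by
  constructor
  · intro h
    constructor
    · intro i
      have e := congrArg (fun v : AddValuation (MvPolynomial σ K) ℕ∞ => v (X i)) h
      rw [← monomialOrd_X (K := K) w i, ← monomialAddVal_apply, ← e]
      exact le_rfl
    · intro i
      have this := congrArg (fun v : AddValuation (MvPolynomial σ K) ℕ∞ => v (Ψ (X i))) h
      have e : ((monomialAddVal w').comap (Ψ.symm : MvPolynomial σ K →+* MvPolynomial σ K))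
          (Ψ (X i)) = monomialOrd w' (X i : MvPolynomial σ K) := by
        show monomialOrd w' (Ψ.symm (Ψ (X i))) = _
        rw [AlgEquiv.symm_apply_apply]
      rw [← monomialAddVal_apply w, ← this, e, monomialOrd_X]
  · rintro ⟨h1, h2⟩
    ext F
    apply le_antisymm
    · have hdom := monomialOrd_le_addValuation
        ((monomialAddVal w).comap (Ψ : MvPolynomial σ K →+* MvPolynomial σ K)) w'
        (fun i => h2 i) (Ψ.symm F)
      have e : ((monomialAddVal w).comap (Ψ : MvPolynomial σ K →+* MvPolynomial σ K)) (Ψ.symm F)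
          = monomialOrd w F := by
        show monomialOrd w (Ψ (Ψ.symm F)) = _
        rw [AlgEquiv.apply_symm_apply]
      rw [e] at hdom
      exact hdom
    · exact monomialOrd_le_addValuation _ w (fun i => h1 i) F

/-! ## §7 Two facts read off the minimum formula: units and the first-entry bound -/

omit [IsDomain K] in
/-- A polynomial with non-zero constant term (a unit of the local ring at the origin) has
`ν_w = 0`. [cite: AbramovichQuekSchober2024, §4 (v_J(g) = min over the monomials of g; the
constant monomial has value 0)] -/
theorem monomialOrd_eq_zero_of_constantCoeff_ne_zero (w : σ → ℕ) {F : MvPolynomial σ K}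
    (h : constantCoeff F ≠ 0) : monomialOrd w F = 0 := by
  have h0 : (0 : σ →₀ ℕ) ∈ F.support := by
    rw [mem_support_iff, ← constantCoeff_eq]; exact h
  exact nonpos_iff_eq_zero.mp (by simpa using monomialOrd_le_weight w h0)

omit [IsDomain K] in
/-- **Units do not change `v_J`: `ν_w(u·G) = ν_w(G)` when `u(0) ≠ 0`** (over a domain) — the
unit clause of the transport of admissibility under `u·(f∘σ)`.
[cite: AbramovichQuekSchober2024, §4 (v_J a valuation on 𝒪 ∖ {0})];
[cite: AbramovichTemkinWlodarczyk2024, Rem. 5.2.3] -/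
theorem monomialOrd_mul_of_constantCoeff_ne_zero [NoZeroDivisors K] (w : σ → ℕ)
    {u : MvPolynomial σ K} (hu : constantCoeff u ≠ 0) (G : MvPolynomial σ K) :
    monomialOrd w (u * G) = monomialOrd w G := by
  rw [monomialOrd_mul, monomialOrd_eq_zero_of_constantCoeff_ne_zero w hu, zero_add]

omit [IsDomain K] in
/-- **First-entry bound: `a₁ ≤ ord(F)`.** If the centre with integer weights `w ≤ W` (`W = N/a₁`
for the smallest exponent `a₁`) is admissible for `F` (`N ≤ ν_w F`), then `N ≤ W·|d|` for every
monomial `d` of `F` — in particular for one of minimal degree: `a₁ = N/W ≤ ord F`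
("since `(y₁^{b₁}, y₂^{b₂})` is admissible and `b₁ ≤ b₂`, we have `b₁ ≤ ν`").
[cite: AbramovichQuekSchober2024, proof of Thm. 4.2 ("Uniqueness of a₁")] -/
theorem le_mul_degree_of_le_monomialOrd (w : σ → ℕ) {W N : ℕ} (hW : ∀ i, w i ≤ W)
    {F : MvPolynomial σ K} (hN : (N : ℕ∞) ≤ monomialOrd w F) {d : σ →₀ ℕ} (hd : d ∈ F.support) :
    N ≤ W * d.degree := by
  have h1 : N ≤ Finsupp.weight w d := (le_monomialOrd_iff w F N).mp hN d hd
  refine h1.trans ?_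
  rw [Finsupp.weight_apply, Finsupp.sum, Finsupp.degree_apply, Finset.mul_sum]
  exact Finset.sum_le_sum fun i _ => by
    show d i • w i ≤ W * d i
    rw [smul_eq_mul, mul_comm]; exact Nat.mul_le_mul_right _ (hW i)

omit [IsDomain K] in
/-- In cocharacter form: `J` admissible for `F` and `γᵢ ≤ 1/a` for all `i` ⟹ `a ≤ |d|` for every
monomial `d` of `F` (`a ≤ ord F`). [cite: AbramovichQuekSchober2024, proof of Thm. 4.2
("Uniqueness of a₁": b₁ ≤ ν)] -/
theorem le_degree_of_isAdmissibleFor {γ : σ → ℚ} {F : MvPolynomial σ K} (hF : IsAdmissibleFor γ F)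
    {a : ℚ} (ha : 0 < a) (hγ : ∀ i, γ i ≤ 1 / a) {d : σ →₀ ℕ} (hd : d ∈ F.support) :
    a ≤ d.degree := by
  have h1 := hF d hd
  have h2 : monomialValuation γ d ≤ (d.degree : ℚ) * (1 / a) := by
    rw [monomialValuation, Finsupp.sum, Finsupp.degree_apply, Nat.cast_sum, Finset.sum_mul]
    exact Finset.sum_le_sum fun i _ => mul_le_mul_of_nonneg_left (hγ i) (Nat.cast_nonneg _)
  have h3 : (1 : ℚ) ≤ d.degree * (1 / a) := h1.trans h2
  rwa [mul_one_div, le_div_iff₀ ha, one_mul] at h3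

/-! ## §8 Rigidity: parameters of the same weights that dominate the old ones give the same valuation -/

/-- A SURJECTIVE endomorphism `f` of a Noetherian ring with `I ≤ f⁻¹(I)` (i.e. `f(I) ⊆ I`)
satisfies `f⁻¹(I) = I`: the ascending chain `I ≤ f⁻¹I ≤ f⁻²I ≤ ⋯` is stationary and `f⁻¹` is
injective on ideals. [folklore] -/
private theorem comap_eq_of_le_comap_of_surjective {R : Type*} [Semiring R] [IsNoetherianRing R]
    (f : R →+* R) (hf : Function.Surjective f) (I : Ideal R) (hI : I ≤ I.comap f) :
    I.comap f = I := by
  let c : Ideal R → Ideal R := Ideal.comap f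
  have hc : Monotone c := fun _ _ h => Ideal.comap_mono h
  have hinj : Function.Injective c := Ideal.comap_injective_of_surjective f hf
  have hmono : Monotone fun n : ℕ => c^[n] I := by
    refine monotone_nat_of_le_succ fun n => ?_
    induction n with
    | zero => exact hI
    | succ n ih =>
      rw [Function.iterate_succ_apply', Function.iterate_succ_apply']
      exact hc ih
  obtain ⟨N, hN⟩ :=
    (monotone_stabilizes_iff_noetherian.mpr (inferInstance : IsNoetherian R R)) ⟨_, hmono⟩
  have hN' : c^[N] I = c^[N + 1] I := hN (N + 1) (Nat.le_succ N)
  suffices h : ∀ n, c^[n] I = c^[n + 1] I → c I = I from h N hN'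
  intro n
  induction n with
  | zero => intro h; exact h.symm
  | succ n ih =>
    intro h
    rw [Function.iterate_succ_apply', Function.iterate_succ_apply'] at h
    exact ih (hinj h)

/-- **Domination under a change of parameters.** If `φ` is a ring endomorphism of `K[x]` with
`ν_w(φ(xᵢ)) ≥ wᵢ` for all `i` (the new elements `xᵢ' = φ(xᵢ)` have at least the old weights), then
`ν_w(φ(G)) ≥ ν_w(G)` for every `G` ("expand `G` in `x`, apply `φ` termwise": `ν_w ∘ φ` is a
valuation dominating the weights, §5).  [cite: AbramovichTemkinWlodarczyk2024, Lemma 5.2.10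
(p. 1577) and its proof ("(x₁^{a₁}, …, x_k^{a_k}) ≤ v(x₁'^{a₁}) implies that x₁'^{a₁} lies in the
integral closure")]; [cite: AbramovichQuekSchober2024, §4 (v_J determined by v_J(xᵢ) = 1/aᵢ)] -/
theorem monomialOrd_le_monomialOrd_map (w : σ → ℕ)
    (φ : MvPolynomial σ K →+* MvPolynomial σ K)
    (h : ∀ i, (w i : ℕ∞) ≤ monomialOrd w (φ (X i))) (G : MvPolynomial σ K) :
    monomialOrd w G ≤ monomialOrd w (φ G) :=
  monomialOrd_le_addValuation ((monomialAddVal w).comap φ) w h G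

section Rigidity

variable [Finite σ] [IsNoetherianRing K]

/-- **Rigidity of the monomial valuation (Lemma 5.2.10 for a simultaneous change of all
parameters): `ν_w(Ψ G) = ν_w(G)` for every `G`**, for an automorphism `Ψ` of `K[x]` (`σ` finite,
`K` a Noetherian domain) whose new parameters have `ν_w(Ψ(xᵢ)) ≥ wᵢ`.  Proof: the valuation ideal
`F_c = {F : c ≤ ν_w F}` (the `I_γ` of Def. 2.2.1; an ideal for every weight vector, weights `0`
included) satisfies `F_c ≤ Ψ⁻¹F_c` by domination, the chain `F_c ≤ Ψ⁻¹F_c ≤ Ψ⁻²F_c ≤ ⋯` is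
stationary because `K[x]` is Noetherian, and `Ψ⁻¹` is injective on ideals, so `Ψ⁻¹(F_c) = F_c`;
take `c = ν_w(Ψ G)`.  The published Lemma 5.2.10 moves one parameter (`(x₁^{a₁}, x₂^{a₂}, …,
x_k^{a_k}) ≤ v(x₁'^{a₁})` ⟹ the two centres coincide) and argues with the Hilbert–Samuel functions
of the integral closures; here all parameters may move at once.
[cite: AbramovichTemkinWlodarczyk2024, Lemma 5.2.10 (p. 1577), Def. 2.2.1 (p. 1567: the ideals
I_γ = {f | v(f) ≥ γ_v}) and Thm. 5.3.1 (3) (p. 1578: "J is the unique admissible center with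
invariant inv_I(p) … independent of the maximal contact sequence")];
[cite: AbramovichQuekSchober2024, §4 ("the data of (x₁, x₂) and (a₁, a₂) determines the
valuation but is not uniquely determined by it")] -/
theorem monomialOrd_ringEquiv_eq (w : σ → ℕ) (Ψ : MvPolynomial σ K ≃+* MvPolynomial σ K)
    (h : ∀ i, (w i : ℕ∞) ≤ monomialOrd w (Ψ (X i))) (G : MvPolynomial σ K) :
    monomialOrd w (Ψ G) = monomialOrd w G := by
  refine le_antisymm ?_ (monomialOrd_le_monomialOrd_map w Ψ h G)
  -- the valuation ideal `F_c`, `c := ν_w(Ψ G)`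
  let I : Ideal (MvPolynomial σ K) :=
    { carrier := {F | monomialOrd w (Ψ G) ≤ monomialOrd w F}
      zero_mem' := by simp [monomialOrd_zero]
      add_mem' := fun {F F'} hF hF' => (le_min hF hF').trans (min_monomialOrd_le_add w F F')
      smul_mem' := fun F {F'} hF' => by
        show monomialOrd w (Ψ G) ≤ monomialOrd w (F * F')
        exact hF'.trans (le_add_self.trans (add_monomialOrd_le_mul w F F')) }
  have hs : Function.Surjective (Ψ : MvPolynomial σ K →+* MvPolynomial σ K) := Ψ.surjective
  -- `F_c ≤ Ψ⁻¹ F_c` by domination, hence `Ψ⁻¹ F_c = F_c`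
  have hI : I ≤ I.comap (Ψ : MvPolynomial σ K →+* MvPolynomial σ K) := fun F hF =>
    (show monomialOrd w (Ψ G) ≤ monomialOrd w F from hF).trans
      (monomialOrd_le_monomialOrd_map w Ψ h F)
  have hfix := comap_eq_of_le_comap_of_surjective _ hs I hI
  have hG : G ∈ I.comap (Ψ : MvPolynomial σ K →+* MvPolynomial σ K) :=
    show monomialOrd w (Ψ G) ≤ monomialOrd w (Ψ G) from le_rfl
  rw [hfix] at hG
  exact hG

/-- **The new parameters have EXACTLY the old weights: `ν_w(Ψ(xᵢ)) = wᵢ`.**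
[cite: AbramovichTemkinWlodarczyk2024, Lemma 5.2.10 (p. 1577)] -/
theorem monomialOrd_ringEquiv_X (w : σ → ℕ) (Ψ : MvPolynomial σ K ≃+* MvPolynomial σ K)
    (h : ∀ i, (w i : ℕ∞) ≤ monomialOrd w (Ψ (X i))) (i : σ) :
    monomialOrd w (Ψ (X i)) = w i := by
  rw [monomialOrd_ringEquiv_eq w Ψ h, monomialOrd_X]

/-- **The one-sided hypothesis is symmetric:** the old parameters written in the new ones also
dominate the weights, `ν_w(Ψ⁻¹(xᵢ)) = wᵢ` — the second condition of `comap_monomialAddVal_eq_iff`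
(§6) is implied by the first.  [cite: AbramovichTemkinWlodarczyk2024, Lemma 5.2.10 (p. 1577) and
Thm. 5.3.1 (3) (p. 1578)] -/
theorem monomialOrd_ringEquiv_symm_X (w : σ → ℕ) (Ψ : MvPolynomial σ K ≃+* MvPolynomial σ K)
    (h : ∀ i, (w i : ℕ∞) ≤ monomialOrd w (Ψ (X i))) (i : σ) :
    monomialOrd w (Ψ.symm (X i)) = w i := by
  rw [← monomialOrd_ringEquiv_eq w Ψ h (Ψ.symm (X i)), RingEquiv.apply_symm_apply, monomialOrd_X]

/-- `ν_w(Ψ⁻¹ G) = ν_w(G)` as well. [cite: AbramovichTemkinWlodarczyk2024, Lemma 5.2.10 (p. 1577)] -/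
theorem monomialOrd_ringEquiv_symm_eq (w : σ → ℕ) (Ψ : MvPolynomial σ K ≃+* MvPolynomial σ K)
    (h : ∀ i, (w i : ℕ∞) ≤ monomialOrd w (Ψ (X i))) (G : MvPolynomial σ K) :
    monomialOrd w (Ψ.symm G) = monomialOrd w G := by
  rw [← monomialOrd_ringEquiv_eq w Ψ h (Ψ.symm G), RingEquiv.apply_symm_apply]

/-- **Rigidity, valuation form (the one-sided sharpening of §6).** For a `K`-algebra automorphism
`Ψ` of `K[x]` (new coordinates `Xᵢ = Ψ(xᵢ)`) with `ν_w(Xᵢ) ≥ wᵢ` for all `i`, the monomial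
valuation of the centre `(Xᵢ^{N/wᵢ})` — `ν_w` of the `X`-coordinates, `μ = ν_w ∘ Ψ⁻¹` — EQUALS
`ν_w`: the centre presented on parameters that dominate the old weights is the same centre (same
valuative `ℚ`-ideal), "independent of the maximal contact sequence".
[cite: AbramovichTemkinWlodarczyk2024, Lemma 5.2.10 (p. 1577), Thm. 5.3.1 (3) (p. 1578)];
[cite: AbramovichQuekSchober2024, §4] -/
theorem comap_monomialAddVal_symm_eq_of_le (w : σ → ℕ)
    (Ψ : MvPolynomial σ K ≃ₐ[K] MvPolynomial σ K)
    (h : ∀ i, (w i : ℕ∞) ≤ monomialOrd w (Ψ (X i))) :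
    (monomialAddVal w).comap (Ψ.symm : MvPolynomial σ K →+* MvPolynomial σ K) =
      monomialAddVal w := by
  refine (comap_monomialAddVal_eq_iff w w Ψ).mpr ⟨fun i => ?_, h⟩
  exact (monomialOrd_ringEquiv_symm_X w (Ψ : MvPolynomial σ K ≃+* MvPolynomial σ K) h i).ge

/-- … and `ν_w ∘ Ψ = ν_w` likewise. [cite: AbramovichTemkinWlodarczyk2024, Lemma 5.2.10 (p. 1577)] -/
theorem comap_monomialAddVal_eq_of_le (w : σ → ℕ)
    (Ψ : MvPolynomial σ K ≃ₐ[K] MvPolynomial σ K)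
    (h : ∀ i, (w i : ℕ∞) ≤ monomialOrd w (Ψ (X i))) :
    (monomialAddVal w).comap (Ψ : MvPolynomial σ K →+* MvPolynomial σ K) = monomialAddVal w := by
  ext G
  exact monomialOrd_ringEquiv_eq w (Ψ : MvPolynomial σ K ≃+* MvPolynomial σ K) h G

/-- **Admissibility is rigid:** with `Ψ` as above, the centre `(Xᵢ^{N/wᵢ})` on the new parameters
is admissible for `F` (`N ≤ μ(F) = ν_w(Ψ⁻¹F)`) iff the old one is (`N ≤ ν_w(F)`).
[cite: AbramovichTemkinWlodarczyk2024, Lemma 5.2.10 (p. 1577) ("(x₁^{a₁}, …) = (x₁'^{a₁}, …) as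
centers") and Rem. 5.2.3] -/
theorem le_monomialOrd_symm_iff (w : σ → ℕ) (Ψ : MvPolynomial σ K ≃ₐ[K] MvPolynomial σ K)
    (h : ∀ i, (w i : ℕ∞) ≤ monomialOrd w (Ψ (X i))) (F : MvPolynomial σ K) (N : ℕ∞) :
    N ≤ monomialOrd w (Ψ.symm F) ↔ N ≤ monomialOrd w F := by
  rw [show monomialOrd w (Ψ.symm F) = monomialOrd w F from
    monomialOrd_ringEquiv_symm_eq w (Ψ : MvPolynomial σ K ≃+* MvPolynomial σ K) h F]

end Rigidity

end

end WeightedBlowup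

end Literature.AlgebraicGeometry.Resolution
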